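import Literature.Geometry.Lorentzian.CoordBoundaryCoercivity
import HarnessLib

/-!
# The boundary coercivity estimate on a compact collar (Chruściel–Delay 2003, (3.4) at ∂M)

Topic `Literature/Geometry/Lorentzian`, coordinate tensor calculus `MetricCoord`. Everything here is
PROVED; no definition and no statement of `Prop` type is introduced.

`IsMetricOn.boundaryCoercivity` (`CoordBoundaryCoercivity.lean`) proves inequality (3.4) of
Chruściel–Delay (Mém. SMF 94 (2003)) for fields supported in a collar `{0 < x < x₀}`, under explicit
bounds on the collar `{0 < x < x₁}`: `m ≤ |∇x|² ≤ M₁`, `|Δx| ≤ M₂`, `|Hess x(v,v)| ≤ M₃|v|²`,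
`Ric(v,v) ≤ ρ|v|²`, `|(tr K)G + 2K|² ≤ w₁`, `|Z|² ≤ z₁`, `|K|² ≤ k₁`, `|∇K|² ≤ k₂`. In the setting of
Thm. 5.9 the data are smooth up to the boundary of a compact manifold, where all these bounds are
automatic. This file derives them from compactness:

* `abs_apply_le_sqrt_normSqAt_mul` — `|β(v,v)| ≤ √|β|² G(v,v)` at a positive definite point;
* **`IsMetricOn.boundaryCoercivity_of_isCompact`** — if the collar `{y ∈ V | 0 < x < x₁}` is
  contained in a compact `C ⊆ V` on which `dx ≠ 0` (`|∇x|² ≠ 0`), then for every `σ > 0` there are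
  `x₀ > 0` and a constant with (3.4) for all `N, Y` smooth on `V` supported in `{0 < x < x₀}`;
* **`IsMetricOn.boundaryCoercivity_of_isCompact_full`** — the same with the full weighted
  `H̊¹ × H̊²` norm `∫ √g e^{2σ/x}(|Y|² + x⁴Q(∇Y) + N² + x⁴|∇N|² + x⁸|Hess N|²)` on the left (the norm
  of (3.5)), from `IsMetricOn.boundaryCoercivity_full`.

## References

* P. T. Chruściel, E. Delay, Mém. Soc. Math. Fr. 94 (2003), §3 Prop. 3.3 (3.4), Thm. 5.9.
  [ChruscielDelay2003]
-/

noncomputable section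

set_option maxSynthPendingDepth 3

open Set Filter Module Function MeasureTheory
open scoped Topology ContDiff

namespace Literature.Geometry.Lorentzian

namespace MetricCoord

variable {E : Type*} [NormedAddCommGroup E] [NormedSpace ℝ E] [FiniteDimensional ℝ E]
  [CompleteSpace E] {ι : Type*} [Fintype ι] [DecidableEq ι] (b : Basis ι ℝ E)
  {G : E → E →L[ℝ] E →L[ℝ] ℝ} {V : Set E} {x : E} {K : E → E →L[ℝ] E →L[ℝ] ℝ} {xf : E → ℝ}

omit [CompleteSpace E] [Fintype ι] [DecidableEq ι] in
/-- **`|β(v,v)| ≤ √|β|²_G G(v,v)`** at a symmetric positive definite point.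
[cite: ONeill1983, Ch. 3, pp. 60–61] -/
theorem abs_apply_le_sqrt_normSqAt_mul (hG : IsMetricOn G V) (hx : x ∈ V)
    (hpos : ∀ v : E, v ≠ 0 → 0 < G x v v) (β : E →L[ℝ] E →L[ℝ] ℝ) (v : E) :
    |β v v| ≤ Real.sqrt (normSqAt G x β) * G x v v := by
  have h := apply_sq_le_normSqAt_mul hG hx hpos β v v
  have hv : 0 ≤ G x v v := by
    by_cases hz : v = 0
    · simp [hz]
    · exact (hpos _ hz).le
  have hn : 0 ≤ normSqAt G x β := normSqAt_nonneg_of_pos hG hx hpos β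
  have h2 : |β v v| ^ 2 ≤ (Real.sqrt (normSqAt G x β) * G x v v) ^ 2 := by
    rw [sq_abs, mul_pow, Real.sq_sqrt hn]; nlinarith [h]
  exact abs_le_of_sq_le_sq' h2 (by positivity) |>.2

section Integral

variable [MeasurableSpace E] [BorelSpace E] (μ : Measure E) [μ.IsAddHaarMeasure]

/-- **Boundary coercivity in the full weighted `H̊¹ × H̊²` norm, compact-collar form.** Let `G`
be Riemannian metric components on `V` (`dim ≠ 1`), `K` a smooth field of symmetric forms, `x`
smooth on `V`, and suppose the collar `{y ∈ V | 0 < x < x₁}` lies in a compact set `C ⊆ V` on which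
`∇x ≠ 0`. Then for every `σ > 0` there are `x₀ > 0` and `A` such that for all `N, Y` smooth on `V`
with compact support in `{0 < x < x₀}`,
`∫ √g e^{2σ/x}(|Y|² + x⁴Q(∇Y)) + ∫ √g e^{2σ/x}(N² + x⁴|∇N|² + x⁸|Hess N|²)
  ≤ A (∫ √g e^{2σ/x}x⁴|R_K|² + ∫ √g e^{2σ/x}x⁸|R_G|²)`
(`R_K = adjHamK N + adjMomKS Y`, `R_G = adjHamG N + adjMomGS Y`, `Q(∇Y) = tr_G G(∇Y·,∇Y·)`), i.e.
`‖Y‖_{H̊¹_{φ,ψ}} + ‖N‖_{H̊²_{φ,ψ}} ≤ A ‖ΦP*(Y,N)‖_{L²_ψ}` near the boundary (the norm of (3.5)):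
the constants of `IsMetricOn.boundaryCoercivity_full` exist by compactness.
[cite: ChruscielDelay2003, Prop. 3.3 (3.4)–(3.5), Thm. 5.9] -/
theorem IsMetricOn.boundaryCoercivity_of_isCompact_full (hG : IsMetricOn G V)
    (hpos : ∀ y ∈ V, ∀ e : E, e ≠ 0 → 0 < G y e e) (hn : finrank ℝ E ≠ 1)
    (hK : ContDiffOn ℝ ∞ K V) (hKs : ∀ y ∈ V, ∀ v w, K y v w = K y w v)
    (hxf : ContDiffOn ℝ ∞ xf V) {x₁ : ℝ} (hx₁ : 0 < x₁) {C : Set E} (hC : IsCompact C) (hCV : C ⊆ V)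
    (hcol : {y ∈ V | 0 < xf y ∧ xf y < x₁} ⊆ C) (hdx : ∀ y ∈ C, gradSqAt G xf y ≠ 0)
    {σ : ℝ} (hσ : 0 < σ) :
    ∃ x₀ : ℝ, 0 < x₀ ∧ ∃ A : ℝ, ∀ (N : E → ℝ) (Y : E → E), ContDiffOn ℝ ∞ N V →
      ContDiffOn ℝ ∞ Y V → HasCompactSupport N → HasCompactSupport Y →
      tsupport N ⊆ {y ∈ V | 0 < xf y ∧ xf y < x₀} → tsupport Y ⊆ {y ∈ V | 0 < xf y ∧ xf y < x₀} →
      ∫ y, sqrtDetGram G b y * (Real.exp (2 * σ / xf y) * G y (Y y) (Y y)) ∂μ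
        + ∫ y, sqrtDetGram G b y * (Real.exp (2 * σ / xf y) * xf y ^ 4
            * mtrAt G y ((G y).bilinearComp (covDAt G Y y) (covDAt G Y y))) ∂μ
        + ∫ y, sqrtDetGram G b y * (Real.exp (2 * σ / xf y) * N y ^ 2) ∂μ
        + ∫ y, sqrtDetGram G b y * (Real.exp (2 * σ / xf y) * xf y ^ 4 * gradSqAt G N y) ∂μ
        + ∫ y, sqrtDetGram G b y * (Real.exp (2 * σ / xf y) * xf y ^ 8
            * normSqAt G y (hessAt G N y)) ∂μ ≤
      A * (∫ y, sqrtDetGram G b y * (Real.exp (2 * σ / xf y) * xf y ^ 4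
              * normSqAt G y (adjHamK G K N y + adjMomKS G Y y)) ∂μ
          + ∫ y, sqrtDetGram G b y * (Real.exp (2 * σ / xf y) * xf y ^ 8
              * normSqAt G y (adjHamG G K N y + adjMomGS G K Y y)) ∂μ) := by
  -- continuity on `C` of the quantities to be bounded
  have cont : ∀ {f : E → ℝ}, ContDiffOn ℝ ∞ f V → ContinuousOn f C := fun hf ↦
    hf.continuousOn.mono hCV
  have hg2 := cont (hG.contDiffOn_gradSqAt hxf)
  have hlap := cont (hG.contDiffOn_lapAt hxf)
  have hhess := cont (hG.contDiffOn_normSqAt (hG.contDiffOn_hessAt hxf))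
  have hric := cont (hG.contDiffOn_normSqAt hG.contDiffOn_ricAt)
  have hKK : ContDiffOn ℝ ∞ (fun y ↦ (K y).comp ((sharpAt G y).comp (K y))) V :=
    hK.clm_comp (hG.contDiffOn_sharpAt.clm_comp hK)
  have htrK : ContDiffOn ℝ ∞ (fun y ↦ mtrAt G y (K y)) V := hG.contDiffOn_mtrAt hK
  have hWf : ContDiffOn ℝ ∞ (fun y ↦ normSqAt G y (mtrAt G y (K y) • G y + (2 : ℝ) • K y)) V :=
    hG.contDiffOn_normSqAt ((htrK.smul hG.contDiffOn).add (hK.const_smul (2 : ℝ)))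
  have hW := cont hWf
  have hZf : ContDiffOn ℝ ∞ (fun y ↦ normSqAt G y (ricAt G y
      - (2 : ℝ) • (K y).comp ((sharpAt G y).comp (K y))
      + (2 * mtrAt G y (K y)) • K y
      + (((finrank ℝ E : ℝ) - 1)⁻¹ * (-scalAt G y
          + 2 * mtrAt G y ((K y).comp ((sharpAt G y).comp (K y)))
          - 2 * mtrAt G y (K y) ^ 2)) • G y)) V := by
    refine hG.contDiffOn_normSqAt ?_
    have h1 : ContDiffOn ℝ ∞ (fun y ↦ (2 * mtrAt G y (K y)) • K y) V :=
      (contDiffOn_const.mul htrK).smul hK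
    have h2 : ContDiffOn ℝ ∞ (fun y ↦ ((finrank ℝ E : ℝ) - 1)⁻¹ * (-scalAt G y
        + 2 * mtrAt G y ((K y).comp ((sharpAt G y).comp (K y))) - 2 * mtrAt G y (K y) ^ 2)) V :=
      contDiffOn_const.mul (((hG.contDiffOn_scalAt.neg).add
        (contDiffOn_const.mul (hG.contDiffOn_mtrAt hKK))).sub (contDiffOn_const.mul (htrK.pow 2)))
    exact ((hG.contDiffOn_ricAt.sub (hKK.const_smul (2 : ℝ))).add h1).add (h2.smul hG.contDiffOn)
  have hZ := cont hZf
  have hKn := cont (hG.contDiffOn_normSqAt hK)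
  have hcov : ContinuousOn (fun y ↦ ∑ k, ∑ l, ginv G b y k l
      * pairAt G y (cov₂At G K y (b k)) (cov₂At G K y (b l))) C := by
    refine cont (ContDiffOn.sum fun k _ ↦ ContDiffOn.sum fun l _ ↦ ?_)
    exact (hG.contDiffOn_ginv b k l).mul (hG.contDiffOn_pairAt
      ((hG.contDiffOn_cov₂At hK).clm_apply contDiffOn_const)
      ((hG.contDiffOn_cov₂At hK).clm_apply contDiffOn_const))
  -- the bounds
  obtain ⟨B₁, hB₁⟩ := hC.exists_bound_of_continuousOn hg2
  obtain ⟨B₂, hB₂⟩ := hC.exists_bound_of_continuousOn hlap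
  obtain ⟨B₃, hB₃⟩ := hC.exists_bound_of_continuousOn hhess
  obtain ⟨B₄, hB₄⟩ := hC.exists_bound_of_continuousOn hric
  obtain ⟨B₅, hB₅⟩ := hC.exists_bound_of_continuousOn hW
  obtain ⟨B₆, hB₆⟩ := hC.exists_bound_of_continuousOn hZ
  obtain ⟨B₇, hB₇⟩ := hC.exists_bound_of_continuousOn hKn
  obtain ⟨B₈, hB₈⟩ := hC.exists_bound_of_continuousOn hcov
  -- the positive lower bound of `|∇x|²` on `C`
  obtain ⟨m, hm, hmle⟩ : ∃ m : ℝ, 0 < m ∧ ∀ y ∈ C, m ≤ gradSqAt G xf y := by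
    by_cases hne : C.Nonempty
    · obtain ⟨y₀, hy₀, hmin⟩ := hC.exists_isMinOn hne hg2
      have hyV := hCV hy₀
      have hi := hG.isInvertible y₀ hyV
      have h0 : 0 ≤ gradSqAt G xf y₀ := by
        rw [gradSqAt_apply, ← apply_sharpAt_apply hi]
        by_cases hz : sharpAt G y₀ (fderiv ℝ xf y₀) = 0
        · simp [hz]
        · exact (hpos y₀ hyV _ hz).le
      exact ⟨gradSqAt G xf y₀, lt_of_le_of_ne h0 (Ne.symm (hdx y₀ hy₀)), fun y hy ↦ hmin hy⟩
    · exact ⟨1, one_pos, fun y hy ↦ (hne ⟨y, hy⟩).elim⟩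
  -- instantiate the estimate
  have habs : ∀ {r B : ℝ}, ‖r‖ ≤ B → r ≤ max B 0 := fun {r B} h ↦
    ((le_abs_self r).trans (Real.norm_eq_abs r ▸ h)).trans (le_max_left _ _)
  have habs' : ∀ {r B : ℝ}, ‖r‖ ≤ B → |r| ≤ max B 0 := fun {r B} h ↦
    (show |r| ≤ B from Real.norm_eq_abs r ▸ h).trans (le_max_left _ _)
  refine hG.boundaryCoercivity_full b μ hpos hn hK hKs hxf hx₁ hm (M₁ := max (max B₁ 0) m)
    (M₂ := max B₂ 0) (M₃ := Real.sqrt (max B₃ 0)) (ρ := Real.sqrt (max B₄ 0)) (w₁ := max B₅ 0)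
    (z₁ := max B₆ 0) (k₁ := max B₇ 0) (k₂ := max B₈ 0)
    (le_max_right _ _) (le_max_right _ _) (Real.sqrt_nonneg _) (Real.sqrt_nonneg _)
    (le_max_right _ _) (le_max_right _ _) (le_max_right _ _) (le_max_right _ _)
    (fun y hy hx hxx ↦ ?_) (fun y hy hx hxx ↦ ?_) (fun y hy hx hxx v ↦ ?_) (fun y hy hx hxx v ↦ ?_)
    (fun y hy hx hxx ↦ ?_) (fun y hy hx hxx ↦ ?_) (fun y hy hx hxx ↦ ?_) (fun y hy hx hxx ↦ ?_) hσ
  · have hyC := hcol ⟨hy, hx, hxx⟩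
    exact ⟨hmle y hyC, (habs (hB₁ y hyC)).trans (le_max_left _ _)⟩
  · exact habs' (hB₂ y (hcol ⟨hy, hx, hxx⟩))
  · have hyC := hcol ⟨hy, hx, hxx⟩
    refine (abs_apply_le_sqrt_normSqAt_mul hG hy (hpos y hy) (hessAt G xf y) v).trans ?_
    have hv : 0 ≤ G y v v := by
      by_cases hz : v = 0
      · simp [hz]
      · exact (hpos y hy _ hz).le
    exact mul_le_mul_of_nonneg_right (Real.sqrt_le_sqrt (habs (hB₃ y hyC))) hv
  · have hyC := hcol ⟨hy, hx, hxx⟩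
    refine (le_abs_self _).trans
      ((abs_apply_le_sqrt_normSqAt_mul hG hy (hpos y hy) (ricAt G y) v).trans ?_)
    have hv : 0 ≤ G y v v := by
      by_cases hz : v = 0
      · simp [hz]
      · exact (hpos y hy _ hz).le
    exact mul_le_mul_of_nonneg_right (Real.sqrt_le_sqrt (habs (hB₄ y hyC))) hv
  · exact habs (hB₅ y (hcol ⟨hy, hx, hxx⟩))
  · exact habs (hB₆ y (hcol ⟨hy, hx, hxx⟩))
  · exact habs (hB₇ y (hcol ⟨hy, hx, hxx⟩))
  · exact habs (hB₈ y (hcol ⟨hy, hx, hxx⟩))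

/-- **Inequality (3.4) of Chruściel–Delay near the boundary, compact-collar form.** Let `G` be
Riemannian metric components on `V` (`dim ≠ 1`), `K` a smooth field of symmetric forms, `x` smooth on
`V`, and suppose the collar `{y ∈ V | 0 < x < x₁}` lies in a compact set `C ⊆ V` on which `∇x ≠ 0`.
Then for every `σ > 0` there are `x₀ > 0` and `A` such that for all `N, Y` smooth on `V` with compact
support in `{0 < x < x₀}`,
`∫ √g e^{2σ/x}|Y|² + ∫ √g e^{2σ/x}N² + ∫ √g e^{2σ/x}x⁴|∇N|² ≤ A (∫ √g e^{2σ/x}x⁴|R_K|² + ∫ √g e^{2σ/x}x⁸|R_G|²)`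
(`R_K = adjHamK N + adjMomKS Y`, `R_G = adjHamG N + adjMomGS Y`): the constants of
`IsMetricOn.boundaryCoercivity` exist by compactness. [cite: ChruscielDelay2003, Prop. 3.3 (3.4), Thm. 5.9] -/
theorem IsMetricOn.boundaryCoercivity_of_isCompact (hG : IsMetricOn G V)
    (hpos : ∀ y ∈ V, ∀ e : E, e ≠ 0 → 0 < G y e e) (hn : finrank ℝ E ≠ 1)
    (hK : ContDiffOn ℝ ∞ K V) (hKs : ∀ y ∈ V, ∀ v w, K y v w = K y w v)
    (hxf : ContDiffOn ℝ ∞ xf V) {x₁ : ℝ} (hx₁ : 0 < x₁) {C : Set E} (hC : IsCompact C) (hCV : C ⊆ V)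
    (hcol : {y ∈ V | 0 < xf y ∧ xf y < x₁} ⊆ C) (hdx : ∀ y ∈ C, gradSqAt G xf y ≠ 0)
    {σ : ℝ} (hσ : 0 < σ) :
    ∃ x₀ : ℝ, 0 < x₀ ∧ ∃ A : ℝ, ∀ (N : E → ℝ) (Y : E → E), ContDiffOn ℝ ∞ N V →
      ContDiffOn ℝ ∞ Y V → HasCompactSupport N → HasCompactSupport Y →
      tsupport N ⊆ {y ∈ V | 0 < xf y ∧ xf y < x₀} → tsupport Y ⊆ {y ∈ V | 0 < xf y ∧ xf y < x₀} →
      ∫ y, sqrtDetGram G b y * (Real.exp (2 * σ / xf y) * G y (Y y) (Y y)) ∂μ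
        + ∫ y, sqrtDetGram G b y * (Real.exp (2 * σ / xf y) * N y ^ 2) ∂μ
        + ∫ y, sqrtDetGram G b y * (Real.exp (2 * σ / xf y) * xf y ^ 4 * gradSqAt G N y) ∂μ ≤
      A * (∫ y, sqrtDetGram G b y * (Real.exp (2 * σ / xf y) * xf y ^ 4
              * normSqAt G y (adjHamK G K N y + adjMomKS G Y y)) ∂μ
          + ∫ y, sqrtDetGram G b y * (Real.exp (2 * σ / xf y) * xf y ^ 8
              * normSqAt G y (adjHamG G K N y + adjMomGS G K Y y)) ∂μ) := by
  obtain ⟨x₀, hx₀, A, h⟩ := hG.boundaryCoercivity_of_isCompact_full b μ hpos hn hK hKs hxf hx₁ hC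
    hCV hcol hdx hσ
  refine ⟨x₀, hx₀, A, fun N Y hN hY hNs hYs hNS hYS ↦ ?_⟩
  have hfull := h N Y hN hY hNs hYs hNS hYS
  have van : ∀ y ∉ tsupport N ∪ tsupport Y,
      covDAt G Y y = 0 ∧ hessAt G N y = 0 := by
    intro y hy
    obtain ⟨hNz, hYz⟩ := eventuallyEq_zero_of_notMem_union hy
    obtain ⟨-, -, hcov, -, hhess0, -⟩ :=
      kidRows_eq_zero_of_eventuallyEq (G := G) (K := K) hNz hYz
    exact ⟨hcov, hhess0⟩
  have hSV : tsupport N ∪ tsupport Y ⊆ V := union_subset (fun y hy ↦ (hNS hy).1)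
    (fun y hy ↦ (hYS hy).1)
  have hQ : 0 ≤ ∫ y, sqrtDetGram G b y * (Real.exp (2 * σ / xf y) * xf y ^ 4
      * mtrAt G y ((G y).bilinearComp (covDAt G Y y) (covDAt G Y y))) ∂μ := by
    refine integral_nonneg fun y ↦ ?_
    show 0 ≤ sqrtDetGram G b y * _
    by_cases hy : y ∈ tsupport N ∪ tsupport Y
    · have hyV := hSV hy
      have hx4 : 0 ≤ xf y ^ 4 := by positivity
      exact mul_nonneg (Real.sqrt_nonneg _) (mul_nonneg (mul_nonneg (Real.exp_nonneg _) hx4)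
        (hG.mtrAt_bilinearComp_nonneg hyV (hpos y hyV) _))
    · rw [(van y hy).1, mtrAt_eq_sum b]
      simp
  have hH : 0 ≤ ∫ y, sqrtDetGram G b y * (Real.exp (2 * σ / xf y) * xf y ^ 8
      * normSqAt G y (hessAt G N y)) ∂μ := by
    refine integral_nonneg fun y ↦ ?_
    show 0 ≤ sqrtDetGram G b y * _
    by_cases hy : y ∈ tsupport N ∪ tsupport Y
    · have hyV := hSV hy
      have hx8 : 0 ≤ xf y ^ 8 := by positivity
      exact mul_nonneg (Real.sqrt_nonneg _) (mul_nonneg (mul_nonneg (Real.exp_nonneg _) hx8)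
        (normSqAt_nonneg_of_pos hG hyV (hpos y hyV) _))
    · rw [(van y hy).2]
      simp [normSqAt_eq_traceCLM]
  linarith only [hfull, hQ, hH]

end Integral

end MetricCoord

end Literature.Geometry.Lorentzian

end
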